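import Mathlib
import Summits.Ventures.PercRepro2.Graph
import Summits.Ventures.PercRepro2.Exploration
import Summits.Ventures.PercRepro2.Harris
import Summits.Ventures.PercRepro2.GibbsPAJoint
import Summits.Ventures.PercRepro2.SepClusterJoint
import Summits.Ventures.PercRepro2.SepClusterSupport
import Summits.Ventures.PercRepro2.SepClusterHarris
import Summits.Ventures.PercRepro2.SepFamJoint
import Summits.Ventures.PercRepro2.SepFamSupport
import Summits.Ventures.PercRepro2.SepFamHarris
import Summits.Ventures.PercRepro2.SepFamPA
import Summits.Ventures.PercRepro2.SepFamCross
import Summits.Ventures.PercRepro2.SepFamClosed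

/-!
# Theorems A and B for all edge weights in `[0, 1]` (blind cell PercRepro2, p3 g12, 2026-08-27;
`proofs/P3-G2.md` §3 Step 4, the density remark for the theorems themselves)

The same five-line continuity argument as `sep_conn_fam_closed`, applied to the positive
association of the separated tuple of clusters (`sep_fam_pa_closed`) and to the negative
association across the separation (`sep_fam_cross_closed`): every expectation involved is a
polynomial in the weights.  Own work; standard axioms.
-/

namespace Summit.Ventures.PercRepro2

namespace SepPA

open Finset Classical Filter Topology

section ClosedAB

variable {V : Type*} {E : Type*} [Fintype V] [Fintype E] [DecidableEq E]
variable (ends : E → Sym2 V)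

omit [Fintype V] in
/-- An expectation is continuous in the edge weights. -/
lemma continuous_expect (f : Config E → ℝ) : Continuous (fun q : E → ℝ => expect q f) := by
  unfold expect
  exact continuous_finsetSum _ (fun ω _ => (continuous_weight ω).mul continuous_const)

omit [Fintype V] [Fintype E] [DecidableEq E] in
/-- The interior path from `p`: `q t e = (1 − t) p e + t/2`. -/
lemma interior_path (p : E → ℝ) (hp : ∀ e, 0 ≤ p e ∧ p e ≤ 1) :
    ∃ q : ℝ → (E → ℝ), Continuous q ∧ q 0 = p ∧
      ∀ t ∈ Set.Ioo (0 : ℝ) 1, ∀ e, 0 < q t e ∧ q t e < 1 := by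
  refine ⟨fun t e => (1 - t) * p e + t * (1 / 2), ?_, ?_, ?_⟩
  · apply continuous_pi
    intro e
    exact (continuous_const.sub continuous_id).mul continuous_const |>.add
      (continuous_id.mul continuous_const)
  · funext e; simp
  · intro t ht e
    obtain ⟨h0, h1⟩ := ht
    obtain ⟨hp0, hp1⟩ := hp e
    constructor <;> nlinarith

omit [Fintype V] [Fintype E] [DecidableEq E] in
/-- A continuous functional of the weights that is non-negative on the interior is non-negative
on the closed cube. -/
lemma nonneg_of_nonneg_interior (F : (E → ℝ) → ℝ) (hF : Continuous F) (p : E → ℝ)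
    (hp : ∀ e, 0 ≤ p e ∧ p e ≤ 1)
    (hint : ∀ q : E → ℝ, (∀ e, 0 < q e ∧ q e < 1) → 0 ≤ F q) : 0 ≤ F p := by
  obtain ⟨q, hq, hq0, hqi⟩ := interior_path p hp
  have hlim : Tendsto (fun t => F (q t)) (𝓝[>] (0 : ℝ)) (𝓝 (F (q 0))) :=
    tendsto_nhdsWithin_of_tendsto_nhds ((hF.comp hq).continuousAt.tendsto)
  have hev : ∀ᶠ t in 𝓝[>] (0 : ℝ), 0 ≤ F (q t) :=
    Filter.eventually_of_mem (Ioo_mem_nhdsGT one_pos) (fun t ht => hint (q t) (hqi t ht))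
  have := ge_of_tendsto hlim hev
  rwa [hq0] at this

/-- **Theorem A for all edge weights in `[0, 1]`.** -/
theorem sep_fam_pa_closed (p : E → ℝ) (hp : ∀ e, 0 ≤ p e ∧ p e ≤ 1) {X Y : Finset V}
    (hXY : Disjoint X Y) (g₁ g₂ : (Y → Set V) → ℝ) (h₁ : Monotone g₁) (h₂ : Monotone g₂) :
    expect p (fun ω => (sepFam ends X Y).indicator (fun _ => (1 : ℝ)) ω * g₁ (expl ends ω Y)) *
      expect p (fun ω => (sepFam ends X Y).indicator (fun _ => (1 : ℝ)) ω * g₂ (expl ends ω Y)) ≤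
    prob p (sepFam ends X Y) *
      expect p (fun ω => (sepFam ends X Y).indicator (fun _ => (1 : ℝ)) ω *
        (g₁ (expl ends ω Y) * g₂ (expl ends ω Y))) := by
  let F : (E → ℝ) → ℝ := fun q =>
    prob q (sepFam ends X Y) *
      expect q (fun ω => (sepFam ends X Y).indicator (fun _ => (1 : ℝ)) ω *
        (g₁ (expl ends ω Y) * g₂ (expl ends ω Y))) -
    expect q (fun ω => (sepFam ends X Y).indicator (fun _ => (1 : ℝ)) ω * g₁ (expl ends ω Y)) *
      expect q (fun ω => (sepFam ends X Y).indicator (fun _ => (1 : ℝ)) ω * g₂ (expl ends ω Y))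
  have hF : Continuous F :=
    ((continuous_prob _).mul (continuous_expect _)).sub
      ((continuous_expect _).mul (continuous_expect _))
  have h := nonneg_of_nonneg_interior F hF p hp (fun q hq => by
    have := sep_fam_pa ends q hq hXY g₁ g₂ h₁ h₂
    simp only [F]
    linarith)
  simp only [F] at h
  linarith

/-- **Theorem B for all edge weights in `[0, 1]`.** -/
theorem sep_fam_cross_closed (p : E → ℝ) (hp : ∀ e, 0 ≤ p e ∧ p e ≤ 1) {X Y : Finset V}
    (hXY : Disjoint X Y) (f : (X → Set V) → ℝ) (g : (Y → Set V) → ℝ) (hf : Monotone f)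
    (hg : Monotone g) :
    prob p (sepFam ends X Y) *
      expect p (fun ω => (sepFam ends X Y).indicator (fun _ => (1 : ℝ)) ω *
        (f (expl ends ω X) * g (expl ends ω Y))) ≤
    expect p (fun ω => (sepFam ends X Y).indicator (fun _ => (1 : ℝ)) ω * f (expl ends ω X)) *
      expect p (fun ω => (sepFam ends X Y).indicator (fun _ => (1 : ℝ)) ω * g (expl ends ω Y)) := by
  let F : (E → ℝ) → ℝ := fun q =>
    expect q (fun ω => (sepFam ends X Y).indicator (fun _ => (1 : ℝ)) ω * f (expl ends ω X)) *
      expect q (fun ω => (sepFam ends X Y).indicator (fun _ => (1 : ℝ)) ω * g (expl ends ω Y)) -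
    prob q (sepFam ends X Y) *
      expect q (fun ω => (sepFam ends X Y).indicator (fun _ => (1 : ℝ)) ω *
        (f (expl ends ω X) * g (expl ends ω Y)))
  have hF : Continuous F :=
    ((continuous_expect _).mul (continuous_expect _)).sub
      ((continuous_prob _).mul (continuous_expect _))
  have h := nonneg_of_nonneg_interior F hF p hp (fun q hq => by
    have := sep_fam_cross ends q hq hXY f g hf hg
    simp only [F]
    linarith)
  simp only [F] at h
  linarith

end ClosedAB

end SepPA

end Summit.Ventures.PercRepro2
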